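import Summits.HodgeConjecture.HodgeConjecture.Theorems.PadicSemiregularLiftHodgeFermatVarietiesPQTwinStructure

/-!
# Level `pq` WITHOUT `p + 2 < q`, III — small multiples of a unit of `ℤ/q` under `p + 2 ≤ q`; unit entries off the fibres of `±b₁`

Part 3 of 5 (Sketch step 2 §0–§1, ll. 448–636). Transport of the tree's `PQFibre` §3–§4 (line `cancel-by-any-claim-lattice`, lead c3) with the hypothesis
`p + 2 < q` replaced by `p < q ∧ 11 ≤ q`: there `p + 2 < q` was used only through the small-cast lemmas `(p : ℤ/q) ± k ≠ 0`, which hold as soon as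
`p + 2 ≤ q` (two odd primes) — `cast_add_one_ne_zeroT`, `cast_ne_zeroT`, `cast_sub_one/two/three_ne_zeroT`, `two_ne_zeroT`, `isUnit_twoT`; then
`false_of_unit_offT`, `not_isUnit_of_pairT`. All names carry the suffix `T`; hypotheses `(hp : 5 ≤ p) (hpq1 : p < q) (hq : 11 ≤ q)`.

PROVENANCE. Cell hodge-nonav (HUMAN RULING D-0038), planner seat p1 g33: chapter ROUTE-P1AF addenda ADD2 ∕ ADD3 (memos `HOME/memos/ROUTE-P1AF-ADD2.md`
d3af0b1bf97b24f6, `…-ADD3.md` 5042c485c3dfa6c1; referee PASS 0∕0: ref g51 REF-P1AF-ADD2.md, REF-P1AF-ADD3.md 5111ed97ffe1fe84), frozen Sketch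
`HOME/p1/route/Sketch_P1AF_TWIN_ALL_g33.lean` (sha16 48c9088b216d60cb, 1063 lines, namespace `HodgeNonAV.P1AF.Twin`, farm rc 0 / 0 sorries / axioms
{propext, Classical.choice, Quot.sound}; re-elaborated 2026-08-28), split into five tree modules `…PQTwinCounting` → `…PQTwinStructure` → `…PQTwinFibre` →
`…PQTwinClassification` → `…PQTwinPayoff` by planner p1 g34 (landing kit HOME/p1/landing/); proof bodies verbatim; docstrings reworded per referee riders
N-ADD2-1 ∕ N-ADD3-1 (hypotheses read `5 ≤ p`, `p < q`, `11 ≤ q` as the theorems carry them; no cell tags; Aoki cites are METHOD attributions — the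
statements at the twin levels are not in print). A parallel `T`-family rather than a weakening of the tree's `PQFibre ∕ PQClassification ∕ PQPayoff`
hypothesis `p + 2 < q`, because Theorems files are append-only; an operator refactor may later merge the two spellings.
Extends line `cancel-by-any-claim-lattice` of crux `HodgeFermatVarieties` (route `PadicSemiregularLift`): land with `--supports stmt-HodgeConjecture-1334`
(or `--supports stmt-HodgeConjecture-19652 --as helper`). No instance, no new notation (Part 5's eight `local notation3` are the line's, verbatim from
`Theorems/PadicSemiregularLiftHodgeFermatVarietiesPQPayoff`), no sorry, no new axiom.
HONEST SCOPE: combinatorics of Hodge `(p+1)`-multisets of `ℤ/pq` and the HC pay-off for the Fermat `(p−1)`-folds `X^{p−1}_{pq}` MODULO the line's named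
facts (S0) and stub statements (S2↑, S2↓, S3a, S5) — exactly the hypotheses of the tree's `PQ.hodgeConjectureFor_pq`; Fermat varieties are dominated by
abelian motives, so this is inside the known (AV) region of the summit; NOTHING here proves the Hodge conjecture.
References (method): N. Aoki, Math. Ann. 266 (1983) Thm A′ (§7), Prop. 2.2 [cite: Aoki1983, Thm. A]; N. Aoki, J. Math. Soc. Japan 39 (1987) §1, Thm 2-1
[cite: Aoki1987, Thm. 2-1]; T. Shioda, Math. Ann. 245 (1979) [cite: Shioda1979PJA, Thm. I].
-/

set_option linter.dupNamespace false
set_option linter.unusedVariables false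

noncomputable section

namespace Summit.HodgeConjecture.HodgeConjecture.Theorems.CancelByAnyClaimLattice.PQTwin

open Finset
open CategoryTheory AlgebraicGeometry
open Literature.AlgebraicGeometry Literature.AlgebraicGeometry.Motives Literature.AlgebraicTopology.SingularHomology
open Literature.AlgebraicGeometry.HodgeTheory Literature.AlgebraicGeometry.HodgeTheory.FermatCharacter
open Summit.HodgeConjecture.HodgeConjecture.Theorems.CancelByAnyClaimLattice.FiveQ
open Summit.HodgeConjecture.HodgeConjecture.Theorems.CancelByAnyClaimLattice.PQ
open Summit.HodgeConjecture.HodgeConjecture.Theorems.CancelByAnyClaimLattice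

/-! ### §0 Small multiples of a unit of `ℤ/q` under `5 ≤ p < q` (two odd primes, so `p + 2 ≤ q`) -/

/-- `p + 1 ≠ 0` in `ℤ/q`. [folklore] -/
theorem cast_add_one_ne_zeroT {p q : ℕ} [Fact p.Prime] [Fact q.Prime] (hp : 5 ≤ p) (hpq1 : p < q) :
    (p : ZMod q) + 1 ≠ 0 := by
  have hpq2 := add_two_le_of_lt hp hpq1
  have key : ((p + 1 : ℕ) : ZMod q) ≠ ((0 : ℕ) : ZMod q) := by
    intro h
    rw [ZMod.natCast_eq_natCast_iff', Nat.mod_eq_of_lt (by omega), Nat.mod_eq_of_lt (by omega)] at h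
    omega
  push_cast at key
  exact key

/-- `p ≠ 0` in `ℤ/q`. [folklore] -/
theorem cast_ne_zeroT {p q : ℕ} [Fact p.Prime] [Fact q.Prime] (hp : 5 ≤ p) (hpq1 : p < q) : (p : ZMod q) ≠ 0 := by
  have key : ((p : ℕ) : ZMod q) ≠ ((0 : ℕ) : ZMod q) := by
    intro h
    rw [ZMod.natCast_eq_natCast_iff', Nat.mod_eq_of_lt (by omega), Nat.mod_eq_of_lt (by omega)] at h
    omega
  push_cast at key
  exact key

/-- `p - 1 ≠ 0` in `ℤ/q`. [folklore] -/
theorem cast_sub_one_ne_zeroT {p q : ℕ} [Fact p.Prime] [Fact q.Prime] (hp : 5 ≤ p) (hpq1 : p < q) :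
    (p : ZMod q) - 1 ≠ 0 := by
  have key : ((p : ℕ) : ZMod q) ≠ ((1 : ℕ) : ZMod q) := by
    intro h
    rw [ZMod.natCast_eq_natCast_iff', Nat.mod_eq_of_lt (by omega), Nat.mod_eq_of_lt (by omega)] at h
    omega
  push_cast at key
  exact sub_ne_zero.mpr key

/-- `p - 2 ≠ 0` in `ℤ/q`. [folklore] -/
theorem cast_sub_two_ne_zeroT {p q : ℕ} [Fact p.Prime] [Fact q.Prime] (hp : 5 ≤ p) (hpq1 : p < q) :
    (p : ZMod q) - 2 ≠ 0 := by
  have key : ((p : ℕ) : ZMod q) ≠ ((2 : ℕ) : ZMod q) := by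
    intro h
    rw [ZMod.natCast_eq_natCast_iff', Nat.mod_eq_of_lt (by omega), Nat.mod_eq_of_lt (by omega)] at h
    omega
  push_cast at key
  exact sub_ne_zero.mpr key

/-- `p - 3 ≠ 0` in `ℤ/q`. [folklore] -/
theorem cast_sub_three_ne_zeroT {p q : ℕ} [Fact p.Prime] [Fact q.Prime] (hp : 5 ≤ p) (hpq1 : p < q) :
    (p : ZMod q) - 3 ≠ 0 := by
  have key : ((p : ℕ) : ZMod q) ≠ ((3 : ℕ) : ZMod q) := by
    intro h
    rw [ZMod.natCast_eq_natCast_iff', Nat.mod_eq_of_lt (by omega), Nat.mod_eq_of_lt (by omega)] at h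
    omega
  push_cast at key
  exact sub_ne_zero.mpr key

/-- `2 ≠ 0` in `ℤ/q`. [folklore] -/
theorem two_ne_zeroT {p q : ℕ} [Fact p.Prime] [Fact q.Prime] (hp : 5 ≤ p) (hpq1 : p < q) : (2 : ZMod q) ≠ 0 := by
  have key : ((2 : ℕ) : ZMod q) ≠ ((0 : ℕ) : ZMod q) := by
    intro h
    rw [ZMod.natCast_eq_natCast_iff', Nat.mod_eq_of_lt (by omega), Nat.mod_eq_of_lt (by omega)] at h
    omega
  push_cast at key
  exact key

/-- `2` is a unit of `ℤ/pq` (`p, q` odd). [folklore] -/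
theorem isUnit_twoT {p q : ℕ} [Fact p.Prime] [Fact q.Prime] (hp : 5 ≤ p) (hpq1 : p < q) :
    IsUnit (2 : ZMod (p * q)) := by
  have : ((2 : ℕ) : ZMod (p * q)) = 2 := by norm_cast
  rw [← this, ZMod.isUnit_iff_coprime, Nat.coprime_two_left]
  exact Nat.odd_mul.mpr ⟨(Fact.out : p.Prime).odd_of_ne_two (by omega), (Fact.out : q.Prime).odd_of_ne_two (by omega)⟩

section LevelPQ

variable {p q : ℕ} [Fact p.Prime] [Fact q.Prime]

/-- **A unit entry outside the fibres of `±b₁` whose negative is not an entry is impossible** (its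
multiplicity would be symmetric). Technical form used twice below. [folklore] -/
theorem false_of_unit_offT (hp : 5 ≤ p) (hpq1 : p < q) (hq : 11 ≤ q) {s : Multiset (ZMod (p * q))} {b₁ : (ZMod q)ˣ}
    {y z : ZMod (p * q)}
    (hs : s = (univ.filter fun x : (ZMod (p * q))ˣ ↦ ZMod.unitsMap (dvd_mul_left q p) x = b₁).val.map
      (fun x : (ZMod (p * q))ˣ ↦ (x : ZMod (p * q))) + {y, z})
    (hoff : ∀ x : (ZMod (p * q))ˣ, ZMod.unitsMap (dvd_mul_left q p) x ≠ b₁ → ZMod.unitsMap (dvd_mul_left q p) x ≠ -b₁ →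
      Multiset.count (x : ZMod (p * q)) s = Multiset.count (-(x : ZMod (p * q))) s)
    (hsum : ZMod.castHom (dvd_mul_left q p) (ZMod q) y + ZMod.castHom (dvd_mul_left q p) (ZMod q) z =
      (1 - (p : ZMod q)) * (b₁ : ZMod q))
    (w : (ZMod (p * q))ˣ) (hwy : (w : ZMod (p * q)) = y)
    (h1 : ZMod.unitsMap (dvd_mul_left q p) w ≠ b₁) (h2 : ZMod.unitsMap (dvd_mul_left q p) w ≠ -b₁) : False := by
  classical
  have hc := hoff w h1 h2
  rw [count_unit_eq hs w, if_neg h1, zero_add] at hc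
  have hcw : 0 < Multiset.count (w : ZMod (p * q)) ({y, z} : Multiset (ZMod (p * q))) :=
    Multiset.count_pos.mpr (by simp [hwy])
  -- so `-w` occurs in `s`; it is a unit off the fibres of `±b₁`, hence in `{y, z}`, hence `-w = z`
  have hnw : ZMod.unitsMap (dvd_mul_left q p) (-w) ≠ b₁ := by rw [unitsMap_neg]; exact fun h ↦ h2 (by rw [← h, neg_neg])
  have hc' := count_unit_eq hs (-w)
  rw [if_neg hnw, zero_add, Units.val_neg] at hc'
  rw [hc'] at hc
  have hmem : -(w : ZMod (p * q)) ∈ ({y, z} : Multiset (ZMod (p * q))) := Multiset.count_pos.mp (by omega)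
  simp only [Multiset.insert_eq_cons, Multiset.mem_cons, Multiset.mem_singleton] at hmem
  have hwz : -(w : ZMod (p * q)) = z := by
    rcases hmem with h | h
    · -- `-w = y = w`: then `2w = 0`, impossible for a unit of odd modulus
      exfalso
      rw [← hwy] at h
      have h2 : (2 : ZMod (p * q)) * (w : ZMod (p * q)) = 0 := by linear_combination -h
      haveI : Fact (1 < p * q) := ⟨lt_of_lt_of_le (by omega : 1 < p) (Nat.le_mul_of_pos_right p (by omega))⟩
      exact (Units.ne_zero w) (((isUnit_twoT hp hpq1).mul_right_eq_zero).mp h2)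
    · exact h
  -- then `ȳ + z̄ = 0 ≠ (1 - p) b₁`
  rw [← hwy, ← hwz, map_neg, add_neg_cancel] at hsum
  refine coef_mul_ne_zero (cast_sub_one_ne_zeroT hp hpq1) b₁ ?_
  linear_combination hsum

/-- **The entry `y` of `s = F + {y, z}` is not a unit** (given the sum conditions and the symmetry off
the fibres of `±b₁`). [folklore] -/
theorem not_isUnit_of_pairT (hp : 5 ≤ p) (hpq1 : p < q) (hq : 11 ≤ q) {s : Multiset (ZMod (p * q))} (hs0 : ∀ x ∈ s, x ≠ 0)
    {b₁ : (ZMod q)ˣ} {y z : ZMod (p * q)}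
    (hs : s = (univ.filter fun x : (ZMod (p * q))ˣ ↦ ZMod.unitsMap (dvd_mul_left q p) x = b₁).val.map
      (fun x : (ZMod (p * q))ˣ ↦ (x : ZMod (p * q))) + {y, z})
    (hoff : ∀ x : (ZMod (p * q))ˣ, ZMod.unitsMap (dvd_mul_left q p) x ≠ b₁ → ZMod.unitsMap (dvd_mul_left q p) x ≠ -b₁ →
      Multiset.count (x : ZMod (p * q)) s = Multiset.count (-(x : ZMod (p * q))) s)
    (hsump : ZMod.castHom (dvd_mul_right p q) (ZMod p) y + ZMod.castHom (dvd_mul_right p q) (ZMod p) z = 0)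
    (hsum : ZMod.castHom (dvd_mul_left q p) (ZMod q) y + ZMod.castHom (dvd_mul_left q p) (ZMod q) z =
      (1 - (p : ZMod q)) * (b₁ : ZMod q)) :
    ¬ IsUnit y := by
  classical
  have hpq : p ≠ q := by omega
  intro hyu
  set w := hyu.unit with hw
  have hwy : (w : ZMod (p * q)) = y := hyu.unit_spec
  have hz0 : z ≠ 0 := hs0 z (by rw [hs]; simp)
  -- `w` lies in the fibre of `b₁` or of `-b₁` (else `false_of_unit_off`)
  by_cases h1 : ZMod.unitsMap (dvd_mul_left q p) w = b₁
  · -- then `z̄ = (1 - p) b₁ - b₁ = -p b₁`; analyse `z`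
    have hyq : ZMod.castHom (dvd_mul_left q p) (ZMod q) y = b₁ := by rw [← hwy, ← coe_unitsMap, h1]
    have hzq : ZMod.castHom (dvd_mul_left q p) (ZMod q) z = -((p : ZMod q) * (b₁ : ZMod q)) := by
      rw [hyq] at hsum; linear_combination hsum
    rcases trichotomy hpq hz0 with hzu | ⟨hzp, -⟩ | ⟨-, hzq0⟩
    · -- `z` unit: in the fibre of `b₁` or `-b₁` or off them
      set v := hzu.unit with hv
      have hvz : (v : ZMod (p * q)) = z := hzu.unit_spec
      by_cases g1 : ZMod.unitsMap (dvd_mul_left q p) v = b₁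
      · -- `z̄ = b₁ = -p b₁`: `(p + 1) b₁ = 0`
        have : ZMod.castHom (dvd_mul_left q p) (ZMod q) z = b₁ := by rw [← hvz, ← coe_unitsMap, g1]
        rw [this] at hzq
        exact coef_mul_ne_zero (cast_add_one_ne_zeroT hp hpq1) b₁ (by linear_combination hzq)
      by_cases g2 : ZMod.unitsMap (dvd_mul_left q p) v = -b₁
      · -- `z̄ = -b₁ = -p b₁`: `(p - 1) b₁ = 0`
        have : ZMod.castHom (dvd_mul_left q p) (ZMod q) z = -(b₁ : ZMod q) := by
          rw [← hvz, ← coe_unitsMap, g2, Units.val_neg]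
        rw [this] at hzq
        exact coef_mul_ne_zero (cast_sub_one_ne_zeroT hp hpq1) b₁ (by linear_combination hzq)
      · -- `z` off the fibres: symmetric argument with the roles of `y`, `z` exchanged
        have hs' : s = (univ.filter fun x : (ZMod (p * q))ˣ ↦ ZMod.unitsMap (dvd_mul_left q p) x = b₁).val.map
            (fun x : (ZMod (p * q))ˣ ↦ (x : ZMod (p * q))) + {z, y} := by rw [hs, Multiset.pair_comm]
        exact false_of_unit_offT hp hpq1 hq hs' hoff (by rw [add_comm]; exact hsum) v hvz g1 g2
    · -- `z` of level `q`: `z ≡ 0 (p)` forces `y ≡ 0 (p)`, but `y` is a unit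
      rw [hzp, add_zero] at hsump
      exact cast_ne_zero_of_isUnit' hyu hsump
    · -- `z` of level `p`: `z̄ = 0 = -p b₁`, impossible
      rw [hzq0] at hzq
      exact coef_mul_ne_zero (cast_ne_zeroT hp hpq1) b₁ (by linear_combination hzq)
  by_cases h2 : ZMod.unitsMap (dvd_mul_left q p) w = -b₁
  · -- then `z̄ = (1 - p) b₁ + b₁ = (2 - p) b₁`
    have hyq : ZMod.castHom (dvd_mul_left q p) (ZMod q) y = -(b₁ : ZMod q) := by
      rw [← hwy, ← coe_unitsMap, h2, Units.val_neg]
    have hzq : ZMod.castHom (dvd_mul_left q p) (ZMod q) z = (2 - (p : ZMod q)) * (b₁ : ZMod q) := by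
      rw [hyq] at hsum; linear_combination hsum
    rcases trichotomy hpq hz0 with hzu | ⟨hzp, -⟩ | ⟨-, hzq0⟩
    · set v := hzu.unit with hv
      have hvz : (v : ZMod (p * q)) = z := hzu.unit_spec
      by_cases g1 : ZMod.unitsMap (dvd_mul_left q p) v = b₁
      · -- `b₁ = (2 - p) b₁`: `(p - 1) b₁ = 0`
        have : ZMod.castHom (dvd_mul_left q p) (ZMod q) z = b₁ := by rw [← hvz, ← coe_unitsMap, g1]
        rw [this] at hzq
        exact coef_mul_ne_zero (cast_sub_one_ne_zeroT hp hpq1) b₁ (by linear_combination hzq)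
      by_cases g2 : ZMod.unitsMap (dvd_mul_left q p) v = -b₁
      · -- `-b₁ = (2 - p) b₁`: `(p - 3) b₁ = 0`
        have : ZMod.castHom (dvd_mul_left q p) (ZMod q) z = -(b₁ : ZMod q) := by
          rw [← hvz, ← coe_unitsMap, g2, Units.val_neg]
        rw [this] at hzq
        exact coef_mul_ne_zero (cast_sub_three_ne_zeroT hp hpq1) b₁ (by linear_combination hzq)
      · have hs' : s = (univ.filter fun x : (ZMod (p * q))ˣ ↦ ZMod.unitsMap (dvd_mul_left q p) x = b₁).val.map
            (fun x : (ZMod (p * q))ˣ ↦ (x : ZMod (p * q))) + {z, y} := by rw [hs, Multiset.pair_comm]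
        exact false_of_unit_offT hp hpq1 hq hs' hoff (by rw [add_comm]; exact hsum) v hvz g1 g2
    · rw [hzp, add_zero] at hsump
      exact cast_ne_zero_of_isUnit' hyu hsump
    · -- `z̄ = 0 = (2 - p) b₁`: `(p - 2) b₁ = 0`
      rw [hzq0] at hzq
      exact coef_mul_ne_zero (cast_sub_two_ne_zeroT hp hpq1) b₁ (by linear_combination hzq)
  · exact false_of_unit_offT hp hpq1 hq hs hoff hsum w hwy h1 h2

end LevelPQ

end Summit.HodgeConjecture.HodgeConjecture.Theorems.CancelByAnyClaimLattice.PQTwin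

end
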